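import Mathlib
import Summits.ResolutionOfSingularities.ResolutionOfSingularities.Theorems.WeightedInvariantLocalWeightedDropTOT2BridgePresentedEntryRegime
import Summits.ResolutionOfSingularities.ResolutionOfSingularities.Theorems.WeightedInvariantLocalWeightedDropTOT2BridgePresentedStepGraph
import Summits.ResolutionOfSingularities.ResolutionOfSingularities.Theorems.WeightedInvariantLocalWeightedDropNCResPresentationDefs

/-!
# TOT2-LINE v1.3, regimes (P)/(L): THE ENTRY (P1) IN THE LEAD'S INTERFACE `PresBy` (res-L1-w43-stub-2 g5)

Sub-problem `ResolutionOfSingularities`, ENGINE crux `stmt-ResolutionOfSingularities-8899` (`LocalWeightedDrop`), inner tame loop at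
`m + 1 = 3`, S-ASM by regimes.  The lead's assembly `TameFourTupleDrop.regimePresented_of_pieces` (…NCResRegimePresentedAssembly,
res-L1-w43-lead-1 g5) takes the entry `hP1` over the record `Decoration.PresBy δ d A N Θ`
(…NCResPresentationDefs).  This file discharges it:
* `exists_straightPresentation_of_goodDir_offLast` — the good-position entry of …TOT2BridgePresentedEntry with the extra bookkeeping that
  NO boundary letter is straightened to `y` (the construction sends the letter `x_l`, `l ≠ j`, to `x_{σ l}` with `σ l ≠ y`; proof verbatim);
* **`Decoration.exists_presBy_of_presented`** — (P1): `Admissible`, `2 ≤ o`, `¬ HCol`, `O ≠ ∅ ∨ GoodDir` ⇒ a record `PresBy δ δ.c A N Θ` with a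
  label IN THE POLYGON REGIME (`InPoly`: with an old letter the label has `A₀ = 0` and is well-prepared; in good position it is lazily prepared
  by a re-centring, which bends no boundary letter since none is on the `y`-axis — …StepPoint `presentation_recentre`; the Newton set is
  non-empty at `o ≥ 2`, …PresentedExit);
* `presBy_hP1` — the hypothesis `hP1` of `stub_regimePresented_of_pieces` / `stub_regimeLetter_of_pieces` VERBATIM ((Px) is the lead's
  `hPx_holds`, …NCResPresentationAdapter).

All statements are ours (engine bookkeeping); nothing here is a statement of [CJS] or [CP-char2].
-/

set_option linter.dupNamespace false -- mandated namespace of this single-conjunct summit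

noncomputable section

namespace Summit.ResolutionOfSingularities.ResolutionOfSingularities.Theorems

namespace TameFourTupleDrop

open MvPowerSeries Literature.AlgebraicGeometry.Resolution

variable {k : Type} [Field k] {m : ℕ}

/-! ## Private substitution calculus (as in …TOT2BridgePresentedEntry) -/

/-- Constant terms of a composite. -/
private theorem constantCoeff_comp_eq_zero₄ {n : ℕ} {φ θ : Fin n → MvPowerSeries (Fin n) k}
    (hφ0 : ∀ i, constantCoeff (φ i) = 0) (hθ0 : ∀ i, constantCoeff (θ i) = 0) (i : Fin n) : constantCoeff (subst θ (φ i)) = 0 :=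
  constantCoeff_subst_eq_zero (hasSubst_of_constantCoeff_zero hθ0) hθ0 (hφ0 i)

/-- Chain rule for linear parts. -/
private theorem linMat_comp₄ {n : ℕ} (φ : Fin n → MvPowerSeries (Fin n) k) {θ : Fin n → MvPowerSeries (Fin n) k}
    (hθ0 : ∀ i, constantCoeff (θ i) = 0) :
    FormalCoordChange.linMat (fun i => subst θ (φ i)) = FormalCoordChange.linMat φ * FormalCoordChange.linMat θ := by
  ext i j
  simp only [FormalCoordChange.linMat, Matrix.of_apply, Matrix.mul_apply]
  exact CobordantArc.coeff_degree_one_subst θ hθ0 (φ i) _ (Finsupp.degree_single _ _)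

/-- Composition of substitutions. -/
private theorem subst_subst_eq_subst_comp₄ {n : ℕ} {φ θ : Fin n → MvPowerSeries (Fin n) k}
    (hφ0 : ∀ i, constantCoeff (φ i) = 0) (hθ0 : ∀ i, constantCoeff (θ i) = 0) (f : MvPowerSeries (Fin n) k) :
    subst θ (subst φ f) = subst (fun i => subst θ (φ i)) f :=
  subst_comp_subst_apply (hasSubst_of_constantCoeff_zero hφ0) (hasSubst_of_constantCoeff_zero hθ0) f

/-! ## The good-position entry, with the `y`-axis free of boundary letters -/

/-- **STRAIGHT PRESENTATION IN GOOD POSITION, NO BOUNDARY LETTER ON `y`** (the statement of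
`exists_straightPresentation_of_goodDir` with `l′ ≠ y` recorded; proof verbatim). -/
theorem exists_straightPresentation_of_goodDir_offLast [Infinite k] {δ : Decoration k m} (hf : δ.f ≠ 0) (hO : δ.O = ∅)
    {la : k} (hla : la ≠ 0) {ℓ : Fin (m + 1) → k}
    (hcone : ∀ v : Fin (m + 1) → k,
      CobordantChart.initEval (fun _ : Fin (m + 1) => 1) v δ.c (δ.f * ∏ l' ∈ δ.O, X l') = la * dotProduct ℓ v ^ δ.c)
    {j : Fin (m + 1)} (hjE : j ∉ δ.E) (hj : ℓ j ≠ 0) :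
    ∃ (Θ : Fin (m + 1) → MvPowerSeries (Fin (m + 1)) k) (H : MvPowerSeries (Fin (m + 1)) k) (A : Fin δ.c → MvPowerSeries (Fin m) k),
      (∀ i, constantCoeff (Θ i) = 0) ∧ IsUnit (FormalCoordChange.linMat Θ).det ∧
      (∀ l ∈ δ.E, ∃ (l' : Fin (m + 1)) (u : MvPowerSeries (Fin (m + 1)) k), constantCoeff u ≠ 0 ∧ l' ≠ Fin.last m ∧ Θ l = u * X l') ∧
      constantCoeff H ≠ 0 ∧ (∀ j : Fin δ.c, ((δ.c - (j : ℕ) : ℕ) : ℕ∞) < (A j).order) ∧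
      subst Θ (δ.f * ∏ l' ∈ δ.O, X l') =
        H * (X (Fin.last m) ^ δ.c + ∑ j : Fin δ.c, rename (Fin.succAboveEmb (Fin.last m)) (A j) * X (Fin.last m) ^ (j : ℕ)) := by
  classical
  -- with `O = ∅` the product is `f` and `c = o`
  have hprod : (∏ l' ∈ δ.O, (X l' : MvPowerSeries (Fin (m + 1)) k)) = 1 := by rw [hO, Finset.prod_empty]
  have hc : δ.c = δ.o := by rw [Decoration.c, hO, Finset.card_empty, add_zero]
  rw [hprod, mul_one] at hcone ⊢
  have hfo : ((δ.c : ℕ) : ℕ∞) ≤ δ.f.order := by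
    rw [hc, Decoration.o, ENat.coe_toNat (by rw [ne_eq, order_eq_top_iff]; exact hf)]
  -- step 1: the swap `x_j ↔ y`
  set σ := Equiv.swap j (Fin.last m) with hσ
  set ℓ' : Fin (m + 1) → k := fun i => ℓ (σ i) with hℓ'
  have hℓ'last : ℓ' (Fin.last m) = ℓ j := by rw [hℓ']; dsimp only; rw [hσ, Equiv.swap_apply_right]
  have hℓ'ne : ℓ' (Fin.last m) ≠ 0 := by rw [hℓ'last]; exact hj
  set F₁ := subst (fun i => (X (σ i) : MvPowerSeries (Fin (m + 1)) k)) δ.f with hF₁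
  have hF₁cone : ∀ v : Fin (m + 1) → k, CobordantChart.initEval (fun _ : Fin (m + 1) => 1) v δ.c F₁ = la * dotProduct ℓ' v ^ δ.c := by
    intro v
    rw [hF₁, initEval_subst_X_perm, hcone, dotProduct_comp_perm, hℓ', hσ, Equiv.symm_swap]
  -- step 2: the row operation
  obtain ⟨M, hM⟩ : ∃ M : Matrix (Fin (m + 1)) (Fin (m + 1)) k, ∀ i j', M i j' =
      if i = Fin.last m then (if j' = Fin.last m then (ℓ' (Fin.last m))⁻¹ else -(ℓ' j' / ℓ' (Fin.last m))) else (if j' = i then 1 else 0) :=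
    ⟨Matrix.of fun i j' => if i = Fin.last m then (if j' = Fin.last m then (ℓ' (Fin.last m))⁻¹ else -(ℓ' j' / ℓ' (Fin.last m)))
      else (if j' = i then 1 else 0), fun _ _ => rfl⟩
  set F₂ := subst (FormalCoordChange.linSubst M) F₁ with hF₂
  have hF₂cone : ∀ v : Fin (m + 1) → k, CobordantChart.initEval (fun _ : Fin (m + 1) => 1) v δ.c F₂ = la * v (Fin.last m) ^ δ.c := by
    intro v
    rw [hF₂, AxisNormalize.initEval_subst_linSubst (Fin.last m), hF₁cone, dotProduct_rowOp_mulVec hM hℓ'ne]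
  have hσ0 : ∀ i, constantCoeff ((fun i => (X (σ i) : MvPowerSeries (Fin (m + 1)) k)) i) = 0 := fun i => constantCoeff_X _
  have hM0 : ∀ i, constantCoeff (FormalCoordChange.linSubst M i) = 0 := ConeDichotomy.constantCoeff_linSubst M
  have hF₂o : ((δ.c : ℕ) : ℕ∞) ≤ F₂.order :=
    ConeDichotomy.le_order_subst_of_le _ hM0 _ _ (ConeDichotomy.le_order_subst_of_le _ hσ0 _ _ hfo)
  obtain ⟨H, A, hH, hA, hF₂eq⟩ := exists_monicForm_of_lastCone F₂ δ.c hF₂o hla hF₂cone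
  -- the composite change
  refine ⟨fun i => subst (FormalCoordChange.linSubst M) (X (σ i)), H, A, constantCoeff_comp_eq_zero₄ hσ0 hM0, ?_, ?_, hH, hA, ?_⟩
  · rw [linMat_comp₄ (fun i => (X (σ i) : MvPowerSeries (Fin (m + 1)) k)) hM0, Matrix.det_mul]
    refine (NCTransport.isUnit_det_linMat_perm σ).mul ?_
    change IsUnit (Matrix.of fun i j' => coeff (Finsupp.single j' 1) (FormalCoordChange.linSubst M i)).det
    rw [ConeDichotomy.linMat_linSubst, rowOp_det hM]
    exact isUnit_iff_ne_zero.mpr (inv_ne_zero hℓ'ne)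
  · intro l hl
    have hlj : l ≠ j := fun h => hjE (h ▸ hl)
    have hσl : σ l ≠ Fin.last m := by
      rw [hσ]
      intro h
      by_cases hll : l = Fin.last m
      · rw [hll, Equiv.swap_apply_right] at h
        exact hlj (hll.trans h.symm)
      · rw [Equiv.swap_apply_of_ne_of_ne hlj hll] at h
        exact hll h
    refine ⟨σ l, 1, by rw [map_one]; exact one_ne_zero, hσl, ?_⟩
    show subst (FormalCoordChange.linSubst M) (X (σ l)) = 1 * X (σ l)
    rw [subst_X (FormalCoordChange.hasSubst_linSubst M), rowOp_linSubst_of_ne hM hσl, one_mul]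
  · rw [← subst_subst_eq_subst_comp₄ hσ0 hM0, ← hF₁, ← hF₂, hF₂eq]

/-! ## (P1) in the record `PresBy` -/

section Entry

variable {b : MvPowerSeries (Fin (2 + 1)) k} {δ : Decoration k 2}

/-- **(P1) THE ENTRY RECORD** (three letters, `k` infinite): an admissible state with `2 ≤ o`, outside the apex column, with an old letter or
in good position, is RECORDED (`PresBy`) by a label of degree `c` in the polygon regime. -/
theorem Decoration.exists_presBy_of_presented [Infinite k] (hadm : Admissible b δ) (ho : 2 ≤ δ.o) (hnot : ¬ δ.HCol)
    (h : δ.O.Nonempty ∨ δ.GoodDir) :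
    ∃ (A : Fin δ.c → MvPowerSeries (Fin 2) k) (N : Finset (Fin 2)) (Θ : Fin (2 + 1) → MvPowerSeries (Fin (2 + 1)) k),
      δ.PresBy δ.c A N Θ ∧ PolyDescent.InPoly δ.c A := by
  classical
  have hd : 0 < δ.c := by rw [Decoration.c]; omega
  have hf : δ.f ≠ 0 := hadm.2.1.ne_zero
  rcases h with hO | hgood
  · -- an old letter: the straight presentation of …PresentedEntryRegime; the old letter is on `y`, the label has `A₀ = 0`
    obtain ⟨ℓ, hℓ⟩ := Decoration.exists_isDirForm_of_not_hCol hadm ho hnot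
    obtain ⟨Θ, H, A, h0, hdet, hP3, hH, hA, hA0, hP⟩ := Decoration.exists_straightPresentation_of_isDirForm_of_O_nonempty hadm hℓ hO
    have hmv : IsCountMove Θ (fun _ => 1) := ⟨h0, hdet, fun _ => le_rfl, ⟨0, Nat.one_pos⟩⟩
    have hperm := isBPermissible_point hmv hP3
    have hOl := strIdx_eq_last_of_presentation hperm hH hP
    refine ⟨A, Finset.univ.filter fun j : Fin 2 => ∃ l ∈ δ.E, l ∉ δ.O ∧ strIdx Θ l = Fin.castSucc j, Θ,
      ⟨hperm, hOl, fun l hl hlO => ?_, fun j hj => ?_, H, hH, hP⟩, ?_⟩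
    · obtain ⟨l₀, hl₀⟩ := hO
      rcases Fin.eq_castSucc_or_eq_last (strIdx Θ l) with ⟨j, hj⟩ | hlast
      · exact ⟨j, Finset.mem_filter.mpr ⟨Finset.mem_univ _, l, hl, hlO, hj⟩, hj⟩
      · exact absurd (strIdx_injOn hperm hl (δ.O_subset hl₀) (hlast.trans (hOl l₀ hl₀).symm) ▸ hl₀) hlO
    · obtain ⟨-, l, hl, hlO, hs⟩ := Finset.mem_filter.mp hj
      exact ⟨l, hl, hlO, hs⟩
    · exact ⟨PolyDescent.wellPrepared_of_apply_zero_eq_zero hd (hA0 hd), hA,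
        Decoration.newtonSet_nonempty_of_presentation hadm h0 hdet hP3 hH hP rfl ho⟩
  · -- good position: no boundary letter on `y`; prepare lazily by a re-centring
    obtain ⟨hOe, ℓ, ⟨-, la, hla, hcone⟩, j, hjE, hj⟩ := hgood
    obtain ⟨Θ, H, A, h0, hdet, hP3, hH, hA, hP⟩ := exists_straightPresentation_of_goodDir_offLast hf hOe hla hcone hjE hj
    have hmv : IsCountMove Θ (fun _ => 1) := ⟨h0, hdet, fun _ => le_rfl, ⟨0, Nat.one_pos⟩⟩
    have hP3' : ∀ l ∈ δ.E, ∃ (l' : Fin (2 + 1)) (u : MvPowerSeries (Fin (2 + 1)) k), constantCoeff u ≠ 0 ∧ Θ l = u * X l' :=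
      fun l hl => by obtain ⟨l', u, hu, -, h⟩ := hP3 l hl; exact ⟨l', u, hu, h⟩
    have hperm := isBPermissible_point hmv hP3'
    have hny : ∀ l ∈ δ.E, strIdx Θ l ≠ Fin.last 2 := fun l hl => by
      obtain ⟨l', u, hu, hl', h⟩ := hP3 l hl
      rw [strIdx_eq_of_eq_unit_mul_X hu h]; exact hl'
    obtain ⟨hχ0, hposB, hWPB, -⟩ := PolyDescent.isPrepRecentring_prepSelWP (PolyDescent.stub_polyPrep k δ.c hd) hA
    obtain ⟨Θ'', H'', hperm'', hny'', hH'', hP''⟩ := Decoration.presentation_recentre hperm hny hH hP hχ0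
    refine ⟨_, Finset.univ.filter fun j : Fin 2 => ∃ l ∈ δ.E, l ∉ δ.O ∧ strIdx Θ'' l = Fin.castSucc j, Θ'',
      ⟨hperm'', fun l hl => ?_, fun l hl hlO => ?_, fun j hj => ?_, H'', hH'', hP''⟩, hWPB, hposB,
      Decoration.newtonSet_nonempty_of_presentation hadm hperm''.1.1 hperm''.1.2.1 hperm''.2.2.2 hH'' hP'' rfl ho⟩
    · rw [hOe] at hl; exact absurd hl (Finset.notMem_empty l)
    · rcases Fin.eq_castSucc_or_eq_last (strIdx Θ'' l) with ⟨j, hj⟩ | hlast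
      · exact ⟨j, Finset.mem_filter.mpr ⟨Finset.mem_univ _, l, hl, hlO, hj⟩, hj⟩
      · exact absurd hlast (hny'' l hl)
    · obtain ⟨-, l, hl, hlO, hs⟩ := Finset.mem_filter.mp hj
      exact ⟨l, hl, hlO, hs⟩

end Entry

/-! ## The hypothesis `hP1` of `stub_regimePresented_of_pieces` / `stub_regimeLetter_of_pieces`, verbatim -/

/-- **`hP1` OF `stub_regimePresented_of_pieces`.** -/
theorem presBy_hP1 : ∀ (p : ℕ), p.Prime → ∀ (k : Type) [Field k] [CharP k p] [IsAlgClosed k],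
    ∀ (b : MvPowerSeries (Fin 3) k) (δ : Decoration k 2), Admissible b δ → 2 ≤ δ.o → ¬ δ.HCol → (δ.O.Nonempty ∨ δ.GoodDir) →
      ∃ (A : Fin δ.c → MvPowerSeries (Fin 2) k) (N : Finset (Fin 2)) (Θ : Fin 3 → MvPowerSeries (Fin 3) k),
        δ.PresBy δ.c A N Θ ∧ PolyDescent.InPoly δ.c A :=
  fun _ _ _ _ _ _ _ _ hadm ho hnot h => Decoration.exists_presBy_of_presented hadm ho hnot h

end TameFourTupleDrop

end Summit.ResolutionOfSingularities.ResolutionOfSingularities.Theorems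

end
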